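import Literature.NumberTheory.Automorphic.GLnUnipotentRadicalRefinement
import Mathlib.LinearAlgebra.Matrix.Transvection
import HarnessLib

/-!
# The twisted conjugation `n ↦ n γ n⁻¹` on the upper unitriangular group of `GL₃(F)` by a regular
# diagonal `γ`: `∫⁻_{N₃} φ(n γ n⁻¹) dn = ∏_{i<j} ‖1 - t_i/t_j‖_F⁻¹ · ∫⁻_{N₃} φ(n γ) dn`

Topic `NumberTheory/Automorphic`; namespace `Literature.NumberTheory.Automorphic`. KERNEL
mathematics only: theorems, no definition, no named fact, no instance, no `sorry`. Road «D-S1»,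
letter D-S1f (descent of orbital integrals of `GL₃(F)` to the split torus `A`; Rogawski 1990, §4.13
and Lemma 4.13.1: the substitution `n ↦ n γ n⁻¹` on `N` with Jacobian `|D_{G/A}(γ)|^{1/2} δ_B(γ)^{-1/2}`
for `γ = diag(t₁, t₂, t₃)` with distinct entries). Here `N₃ = U_{id}` is the upper unitriangular
group of `GL₃(F)`, decomposed as `N₃ = V ⋉ U` with `U = U_{(2,1)}` the (abelian) unipotent radical of
the standard parabolic of type `(2, 1)` and `V = N₃ ∩ M_{(2,1)} ≅ (F, +)` the root group of the
root `(1, 2)` (`GLnParabolicIntermediateHaar`):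

* §1 (`d T_{ij}(x) d⁻¹ = T_{ij}(d_i x d_j⁻¹)` is the tree's `diagonal_mul_transvection_mul_diagonal_inv`,
  `RootDataGLn`); `boxAd_glDiagonal`, `det_one_sub_boxAd_glDiagonal_fin_three` — the matrix `K_γ` of `Ad(γ)` on the
  box of a two-block parabolic for a DIAGONAL `γ` is diagonal with entries `t_i t_j⁻¹`; for `GL₃`,
  type `(2,1)`: `det(1 - K_γ) = (1 - t₁/t₃)(1 - t₂/t₃)`.
* §2 `mem_unipotentRadicalGL_id_of_eq_transvection`, `mem_standardLeviGL_of_eq_transvection`,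
  `eq_transvection_of_mem_rootGroup_fin_three` — the transvections `1 + x E₁₂` are exactly the
  elements of `V = N₃ ∩ M_{(2,1)}`; `exists_homeomorph_rootGroup_fin_three` — `(F, +) ≃ₜ V`,
  additive ↦ multiplicative.
* §3 `lintegral_upperUnitriangular_three_conj_diagonal_eq_mul` — **for every Haar measure `μ_N` on
  `N₃`, every Borel `φ : GL₃(F) → [0, ∞]` and every `γ = diag(t₁, t₂, t₃)` with pairwise distinct
  entries: `∫⁻_{N₃} φ(n γ n⁻¹) dμ_N = ‖(1 - t₁/t₂)(1 - t₁/t₃)(1 - t₂/t₃)‖_F⁻¹ ∫⁻_{N₃} φ(n γ) dμ_N`**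
  (Haar of `N₃` in the coordinates `v u`; substitution on `U`, `μ_U`-invariance of `Ad(v)`, and the
  substitution `x ↦ (1 - t₁/t₂) x` on `V ≅ F`).

## References

* [Rogawski1990] J. D. Rogawski, *Automorphic Representations of Unitary Groups in Three Variables*
  (1990), §4.13, Lemma 4.13.1 and proof, pp. 69–70; [BernsteinZelevinsky1977] Ann. Sci. ÉNS 10, §2.1.
-/

noncomputable section

open scoped MatrixGroups NNReal ENNReal
open MeasureTheory Measure Matrix Topology

namespace Literature.NumberTheory.Automorphic

open Literature.NumberTheory.GaloisRepresentations.IsNonarchimedeanLocalField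

/-! ### 1. Diagonal conjugation of transvections; `K_γ` for diagonal `γ` -/

section Algebra

variable {R : Type*} [CommRing R] {m : Type*} [Fintype m] [DecidableEq m]

/-- **`K_γ` is diagonal for diagonal `γ`**: for a two-block labelling `c : Fin n → Bool` and
`γ = diag(t)` (`glDiagonal`), the matrix of `Ad(γ)` on the box is `diag(t_i t_j⁻¹)_{(i,j)}`.
[cite: Rogawski1990, §4.13, proof of Lemma 4.13.1, p. 70] -/
theorem boxAd_glDiagonal {n : ℕ} (c : Fin n → Bool) (t : Fin n → Rˣ)
    (hP : glDiagonal n R t ∈ standardParabolicGL R c) :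
    (Matrix.of fun q q' : {i : Fin n // c i = false} × {j : Fin n // c j = true} =>
      (((⟨glDiagonal n R t, hP⟩ : standardParabolicGL R c) : GL (Fin n) R) :
          Matrix (Fin n) (Fin n) R) q.1 q'.1 *
        ((((⟨glDiagonal n R t, hP⟩ : standardParabolicGL R c)⁻¹ : standardParabolicGL R c) :
          GL (Fin n) R) : Matrix (Fin n) (Fin n) R) q'.2 q.2) =
      Matrix.diagonal fun q => (t q.1 : R) * (((t q.2)⁻¹ : Rˣ) : R) := by
  have hinv : ((((⟨glDiagonal n R t, hP⟩ : standardParabolicGL R c)⁻¹ : standardParabolicGL R c) :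
      GL (Fin n) R) : Matrix (Fin n) (Fin n) R) = Matrix.diagonal fun k => (((t k)⁻¹ : Rˣ) : R) := by
    rw [Subgroup.coe_inv, Subgroup.coe_mk, ← map_inv, coe_glDiagonal]; rfl
  ext q q'
  rw [Matrix.of_apply, hinv, Subgroup.coe_mk, coe_glDiagonal, Matrix.diagonal_apply,
    Matrix.diagonal_apply, Matrix.diagonal_apply]
  by_cases hqq : q = q'
  · subst hqq; simp
  · have : ¬ ((q.1 : Fin n) = q'.1 ∧ (q'.2 : Fin n) = q.2) := by
      rintro ⟨h1, h2⟩
      exact hqq (Prod.ext (Subtype.ext h1) (Subtype.ext h2.symm))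
    rw [if_neg hqq]
    by_cases h1 : (q.1 : Fin n) = q'.1
    · rw [if_pos h1, if_neg (fun h2 => this ⟨h1, h2⟩), mul_zero]
    · rw [if_neg h1, zero_mul]

end Algebra

/-! ### 2. The root group `V = N₃ ∩ M_{(2,1)} ≅ (F, +)` -/

section RootGroup

variable {R : Type*} [CommRing R] {m : Type*} [Fintype m] [DecidableEq m] [LinearOrder m]

/-- A transvection `T_{ij}(x)`, `i < j`, lies in the upper unitriangular group `U_{id}`.
[cite: BernsteinZelevinsky1977, §2.1] -/
theorem mem_unipotentRadicalGL_id_of_eq_transvection {i j : m} (hij : i < j) (x : R) (g : GL m R)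
    (hg : (g : Matrix m m R) = Matrix.transvection i j x) :
    g ∈ unipotentRadicalGL R (id : m → m) := by
  rw [mem_unipotentRadicalGL_iff_entry, hg]
  refine ⟨fun a b hab => ?_, fun a b hab => ?_⟩
  · have hab' : b < a := hab
    rw [Matrix.transvection, Matrix.add_apply, Matrix.one_apply, if_neg (ne_of_gt hab'),
      Matrix.single_apply, if_neg, add_zero]
    rintro ⟨rfl, rfl⟩
    exact lt_asymm hij hab'
  · change a = b at hab
    subst hab
    rw [Matrix.transvection, Matrix.add_apply, Matrix.single_apply, if_neg, add_zero]
    rintro ⟨rfl, rfl⟩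
    exact lt_irrefl _ hij

omit [LinearOrder m] in
/-- A transvection `T_{ij}(x)` with `i, j` in the same block lies in the Levi subgroup `M_c`.
[cite: BernsteinZelevinsky1977, §2.1] -/
theorem mem_standardLeviGL_of_eq_transvection {α : Type*} [LinearOrder α] [Fintype α]
    (c : m → α) {i j : m} (hc : c i = c j) (x : R) (g : GL m R)
    (hg : (g : Matrix m m R) = Matrix.transvection i j x) :
    g ∈ standardLeviGL R c := by
  rw [mem_standardLeviGL_iff, hg]
  intro a b hab
  have hab' : a ≠ b := fun h => hab (h ▸ rfl)
  rw [Matrix.transvection, Matrix.add_apply, Matrix.one_apply, if_neg hab', Matrix.single_apply,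
    if_neg, add_zero]
  rintro ⟨rfl, rfl⟩
  exact hab hc

/-- **The elements of `V = N₃ ∩ M_{(2,1)}` are the transvections `T_{01}(x)`**: an upper
unitriangular `g ∈ GL₃` which is block diagonal for the labelling `(false, false, true)` is
`1 + g_{01} E_{01}`. [cite: BernsteinZelevinsky1977, §2.1] -/
theorem eq_transvection_of_mem_rootGroup_fin_three (g : GL (Fin 3) R)
    (hN : g ∈ unipotentRadicalGL R (id : Fin 3 → Fin 3))
    (hM : g ∈ standardLeviGL R ![false, false, true]) :
    (g : Matrix (Fin 3) (Fin 3) R) = Matrix.transvection 0 1 ((g : Matrix (Fin 3) (Fin 3) R) 0 1) := by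
  rw [mem_unipotentRadicalGL_iff_entry] at hN
  rw [mem_standardLeviGL_iff] at hM
  obtain ⟨hbt, hdiag⟩ := hN
  ext a b
  rw [Matrix.transvection, Matrix.add_apply, Matrix.one_apply, Matrix.single_apply]
  fin_cases a <;> fin_cases b
  · simpa using hdiag 0 0 rfl
  · simp
  · simpa using hM 0 2 (by decide)
  · simpa using hbt (show ((id 0 : Fin 3)) < id 1 by decide)
  · simpa using hdiag 1 1 rfl
  · simpa using hM 1 2 (by decide)
  · simpa using hbt (show ((id 0 : Fin 3)) < id 2 by decide)
  · simpa using hbt (show ((id 1 : Fin 3)) < id 2 by decide)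
  · simpa using hdiag 2 2 rfl

variable (F : Type*) [Field F] [ValuativeRel F] [TopologicalSpace F] [IsNonarchimedeanLocalField F]

/-- **`(F, +) ≃ₜ V`**, `x ↦ T_{01}(x) = 1 + x E_{01}`, for the root group
`V = N₃ ∩ M_{(2,1)} ≤ GL₃(F)`: a homeomorphism turning addition into multiplication.
[cite: BernsteinZelevinsky1977, §2.1] -/
theorem exists_homeomorph_rootGroup_fin_three :
    ∃ w : F ≃ₜ ↥(unipotentRadicalGL F (id : Fin 3 → Fin 3) ⊓ standardLeviGL F ![false, false, true]),
      (∀ x, (((w x : ↥(unipotentRadicalGL F (id : Fin 3 → Fin 3) ⊓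
          standardLeviGL F ![false, false, true])) : GL (Fin 3) F) : Matrix (Fin 3) (Fin 3) F) =
        Matrix.transvection 0 1 x) ∧
      ∀ x y, w (x + y) = w x * w y := by
  haveI : IsTopologicalRing F := inferInstance
  have h01 : (0 : Fin 3) ≠ 1 := by decide
  -- the transvection as a unit
  let τ : F → GL (Fin 3) F := fun x =>
    ⟨Matrix.transvection 0 1 x, Matrix.transvection 0 1 (-x),
      by rw [Matrix.transvection_mul_transvection_same _ _ h01, add_neg_cancel, Matrix.transvection_zero],
      by rw [Matrix.transvection_mul_transvection_same _ _ h01, neg_add_cancel, Matrix.transvection_zero]⟩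
  have hτ : ∀ x, ((τ x : GL (Fin 3) F) : Matrix (Fin 3) (Fin 3) F) = Matrix.transvection 0 1 x :=
    fun x => rfl
  have hτmem : ∀ x, τ x ∈ unipotentRadicalGL F (id : Fin 3 → Fin 3) ⊓ standardLeviGL F ![false, false, true] :=
    fun x => ⟨mem_unipotentRadicalGL_id_of_eq_transvection (by decide) x _ (hτ x),
      mem_standardLeviGL_of_eq_transvection _ (by decide) x _ (hτ x)⟩
  have hτadd : ∀ x y, τ (x + y) = τ x * τ y := by
    intro x y
    apply Units.ext
    change Matrix.transvection 0 1 (x + y) = Matrix.transvection 0 1 x * Matrix.transvection 0 1 y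
    rw [Matrix.transvection_mul_transvection_same _ _ h01]
  have hTc : Continuous fun x : F => Matrix.transvection (0 : Fin 3) 1 x := by
    have : (fun x : F => Matrix.transvection (0 : Fin 3) 1 x) =
        fun x => 1 + x • Matrix.single (0 : Fin 3) (1 : Fin 3) (1 : F) := by
      funext x; rw [Matrix.transvection, Matrix.smul_single, smul_eq_mul, mul_one]
    rw [this]
    exact continuous_const.add (continuous_id.smul continuous_const)
  have hτc : Continuous τ := by
    refine Units.continuous_iff.2 ⟨hTc, ?_⟩
    change Continuous fun x : F => Matrix.transvection (0 : Fin 3) 1 (-x)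
    exact hTc.comp continuous_neg
  refine ⟨{ toFun := fun x => ⟨τ x, hτmem x⟩
            invFun := fun v => ((v : GL (Fin 3) F) : Matrix (Fin 3) (Fin 3) F) 0 1
            left_inv := fun x => by
              change (Matrix.transvection (0 : Fin 3) 1 x) 0 1 = x
              simp [Matrix.transvection]
            right_inv := fun v => by
              apply Subtype.ext; apply Units.ext
              change Matrix.transvection 0 1 (((v : GL (Fin 3) F) : Matrix (Fin 3) (Fin 3) F) 0 1) = _
              exact (eq_transvection_of_mem_rootGroup_fin_three (v : GL (Fin 3) F) v.2.1 v.2.2).symm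
            continuous_toFun := hτc.subtype_mk _
            continuous_invFun :=
              (Units.continuous_val.comp continuous_subtype_val).matrix_elem 0 1 },
    fun x => rfl, fun x y => Subtype.ext (hτadd x y)⟩

end RootGroup

/-! ### 3. The substitution on `N₃` -/

section Assembly

variable (F : Type*) [Field F] [ValuativeRel F] [TopologicalSpace F] [IsNonarchimedeanLocalField F]
  [MeasurableSpace F] [BorelSpace F] [MeasurableSpace (GL (Fin 3) F)] [BorelSpace (GL (Fin 3) F)]

/-- **The twisted conjugation on the upper unitriangular group of `GL₃(F)` by a regular diagonal
element.** Let `γ ∈ P_{(2,1)}(F)` be the diagonal matrix `diag(t₀, t₁, t₂)` with `t₀ ≠ t₁` and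
`det(1 - K_γ) ≠ 0` (`K_γ = diag(t₀/t₂, t₁/t₂)` the adjoint action on the box, `boxAd_glDiagonal`; the
condition is `t₀ ≠ t₂`, `t₁ ≠ t₂`). Then for every Haar measure `μ_N` on `N₃ = U_{id}(F)` and every
Borel `φ : GL₃(F) → [0, ∞]`:
**`∫⁻_{N₃} φ(n γ n⁻¹) dμ_N = ‖det(1 - K_γ)‖_F⁻¹ ‖1 - t₀/t₁‖_F⁻¹ ∫⁻_{N₃} φ(n γ) dμ_N`**, i.e. the
Jacobian is `∏_{i<j} ‖1 - t_i/t_j‖_F⁻¹` (Rogawski 1990, proof of Lemma 4.13.1: `N₃ = N_M ⋉ U`, the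
two-block substitution on `U`, conjugation-invariance of `μ_U` under `N_M`, and the substitution
`x ↦ (1 - t₀/t₁) x` on `N_M ≅ F`). [cite: Rogawski1990, §4.13, proof of Lemma 4.13.1, p. 70] -/
theorem lintegral_upperUnitriangular_three_conj_diagonal_eq_mul (t : Fin 3 → Fˣ)
    (h01 : (t 0 : F) ≠ t 1) (γ : standardParabolicGL F ![false, false, true])
    (hγ : (γ : GL (Fin 3) F) = glDiagonal 3 F t)
    (hK : (1 - Matrix.of fun q q' : {i : Fin 3 // ![false, false, true] i = false} ×
        {j : Fin 3 // ![false, false, true] j = true} =>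
      ((γ : GL (Fin 3) F) : Matrix (Fin 3) (Fin 3) F) q.1 q'.1 *
        (((γ⁻¹ : standardParabolicGL F ![false, false, true]) : GL (Fin 3) F) :
          Matrix (Fin 3) (Fin 3) F) q'.2 q.2).det ≠ 0)
    (μN : Measure ↥(unipotentRadicalGL F (id : Fin 3 → Fin 3))) [IsHaarMeasure μN]
    (φ : GL (Fin 3) F → ℝ≥0∞) (hφ : Measurable φ) :
    ∫⁻ n, φ ((n : GL (Fin 3) F) * (γ : GL (Fin 3) F) * (n : GL (Fin 3) F)⁻¹) ∂μN =
      ((normAbs F ((1 - Matrix.of fun q q' : {i : Fin 3 // ![false, false, true] i = false} ×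
            {j : Fin 3 // ![false, false, true] j = true} =>
          ((γ : GL (Fin 3) F) : Matrix (Fin 3) (Fin 3) F) q.1 q'.1 *
            (((γ⁻¹ : standardParabolicGL F ![false, false, true]) : GL (Fin 3) F) :
              Matrix (Fin 3) (Fin 3) F) q'.2 q.2).det)⁻¹ *
          normAbs F (1 - (t 0 : F) * (t 1 : F)⁻¹)⁻¹ : ℝ≥0) : ℝ≥0∞) *
        ∫⁻ n, φ ((n : GL (Fin 3) F) * (γ : GL (Fin 3) F)) ∂μN := by
  classical
  haveI : T2Space F := (isLocalField F).toT2Space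
  haveI : SecondCountableTopology F := secondCountableTopology_localField F
  haveI : LocallyCompactSpace F := (isLocalField F).toLocallyCompactSpace
  haveI : IsTopologicalRing F := inferInstance
  haveI : SecondCountableTopology (Matrix (Fin 3) (Fin 3) F) :=
    inferInstanceAs (SecondCountableTopology (Fin 3 → Fin 3 → F))
  haveI : SecondCountableTopology (Matrix (Fin 3) (Fin 3) F)ᵐᵒᵖ :=
    MulOpposite.opHomeomorph.symm.secondCountableTopology
  haveI : SecondCountableTopology (GL (Fin 3) F) :=
    Units.isEmbedding_embedProduct.secondCountableTopology
  haveI : LocallyCompactSpace (Matrix (Fin 3) (Fin 3) F) :=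
    inferInstanceAs (LocallyCompactSpace (Fin 3 → Fin 3 → F))
  haveI : LocallyCompactSpace (GL (Fin 3) F) := inferInstance
  have hmono : Monotone (![false, false, true] : Fin 3 → Bool) := by decide
  have hUN : unipotentRadicalGL F ![false, false, true] ≤ unipotentRadicalGL F (id : Fin 3 → Fin 3) :=
    unipotentRadicalGL_comp_le (R := F) (id : Fin 3 → Fin 3) hmono
  have hNP : unipotentRadicalGL F (id : Fin 3 → Fin 3) ≤ standardParabolicGL F ![false, false, true] :=
    unipotentRadicalGL_le_standardParabolicGL_comp (R := F) (id : Fin 3 → Fin 3) hmono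
  have hNc : IsClosed ((unipotentRadicalGL F (id : Fin 3 → Fin 3) : Subgroup (GL (Fin 3) F)) :
      Set (GL (Fin 3) F)) := isClosed_unipotentRadicalGL (id : Fin 3 → Fin 3)
  haveI : SecondCountableTopology ↥(unipotentRadicalGL F ![false, false, true]) :=
    TopologicalSpace.Subtype.secondCountableTopology _
  haveI : BorelSpace ↥(unipotentRadicalGL F ![false, false, true]) := Subtype.borelSpace _
  haveI : LocallyCompactSpace ↥(unipotentRadicalGL F ![false, false, true]) :=
    (isClosed_unipotentRadicalGL (![false, false, true] : Fin 3 → Bool)).locallyCompactSpace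
  haveI : BorelSpace ↥(unipotentRadicalGL F (id : Fin 3 → Fin 3) ⊓ standardLeviGL F ![false, false, true]) :=
    Subtype.borelSpace _
  haveI : SecondCountableTopology
      ↥(unipotentRadicalGL F (id : Fin 3 → Fin 3) ⊓ standardLeviGL F ![false, false, true]) :=
    TopologicalSpace.Subtype.secondCountableTopology _
  set μU : Measure ↥(unipotentRadicalGL F ![false, false, true]) := Measure.haar with hμU
  haveI : SFinite μU := inferInstance
  obtain ⟨w, hw, hwadd⟩ := exists_homeomorph_rootGroup_fin_three F
  set μF : Measure F := Measure.addHaar with hμF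
  set αV : Measure ↥(unipotentRadicalGL F (id : Fin 3 → Fin 3) ⊓ standardLeviGL F ![false, false, true]) :=
    Measure.map w μF with hαV
  haveI : IsHaarMeasure αV := isHaarMeasure_map_of_map_add w hwadd μF
  obtain ⟨κ₀, -, -, hA⟩ := exists_lintegral_haar_eq_mul_lintegral_lintegral F hNc hUN hNP μN αV μU
  set J : ℝ≥0 := normAbs F ((1 - Matrix.of fun q q' : {i : Fin 3 // ![false, false, true] i = false} ×
        {j : Fin 3 // ![false, false, true] j = true} =>
      ((γ : GL (Fin 3) F) : Matrix (Fin 3) (Fin 3) F) q.1 q'.1 *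
        (((γ⁻¹ : standardParabolicGL F ![false, false, true]) : GL (Fin 3) F) :
          Matrix (Fin 3) (Fin 3) F) q'.2 q.2).det)⁻¹ with hJ
  set b : F := 1 - (t 0 : F) * (t 1 : F)⁻¹ with hb
  have hb0 : b ≠ 0 := by
    rw [hb]; refine sub_ne_zero.2 fun h1 => h01 ?_
    have := congrArg (fun x : F => x * (t 1 : F)) h1
    simpa [mul_assoc] using this.symm
  have hcont₁ : Continuous fun g : GL (Fin 3) F => g * (γ : GL (Fin 3) F) * g⁻¹ :=
    (continuous_id.mul continuous_const).mul continuous_inv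
  have hG₁ : Measurable fun g : GL (Fin 3) F => φ (g * (γ : GL (Fin 3) F) * g⁻¹) :=
    hφ.comp hcont₁.measurable
  have hG₂ : Measurable fun g : GL (Fin 3) F => φ (g * (γ : GL (Fin 3) F)) :=
    hφ.comp (continuous_id.mul continuous_const).measurable
  have hvu : Continuous fun q : ↥(unipotentRadicalGL F (id : Fin 3 → Fin 3) ⊓
      standardLeviGL F ![false, false, true]) × ↥(unipotentRadicalGL F ![false, false, true]) =>
      (q.1 : GL (Fin 3) F) * (q.2 : GL (Fin 3) F) :=
    (continuous_subtype_val.comp continuous_fst).mul (continuous_subtype_val.comp continuous_snd)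
  -- (B)+(C): unfold `μ_N`, pass to the product, substitute on `U`
  rw [hA _ hG₁, hA _ hG₂]
  have hm₁ : Measurable fun q : ↥(unipotentRadicalGL F (id : Fin 3 → Fin 3) ⊓
      standardLeviGL F ![false, false, true]) × ↥(unipotentRadicalGL F ![false, false, true]) =>
      φ ((q.1 : GL (Fin 3) F) * (q.2 : GL (Fin 3) F) * (γ : GL (Fin 3) F) *
        ((q.1 : GL (Fin 3) F) * (q.2 : GL (Fin 3) F))⁻¹) := hG₁.comp hvu.measurable
  have hm₂ : Measurable fun q : ↥(unipotentRadicalGL F (id : Fin 3 → Fin 3) ⊓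
      standardLeviGL F ![false, false, true]) × ↥(unipotentRadicalGL F ![false, false, true]) =>
      φ ((q.1 : GL (Fin 3) F) * ((q.2 : GL (Fin 3) F) * (γ : GL (Fin 3) F)) *
        (q.1 : GL (Fin 3) F)⁻¹) :=
    hφ.comp (((continuous_subtype_val.comp continuous_fst).mul
      ((continuous_subtype_val.comp continuous_snd).mul continuous_const)).mul
      (continuous_subtype_val.comp continuous_fst).inv).measurable
  have hC := lintegral_prod_unipotent_conj_eq_mul αV
    (fun v : ↥(unipotentRadicalGL F (id : Fin 3 → Fin 3) ⊓ standardLeviGL F ![false, false, true]) =>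
      (v : GL (Fin 3) F)) μU γ hK φ
  rw [lintegral_prod _ hm₁.aemeasurable, lintegral_prod _ hm₂.aemeasurable] at hC
  simp only at hC
  rw [hC]
  -- (D) for each `v`: conjugation by `v` preserves `μ_U`, so `φ(v (u γ) v⁻¹) ↦ φ(u (v γ v⁻¹))`
  have hD : ∀ v : ↥(unipotentRadicalGL F (id : Fin 3 → Fin 3) ⊓ standardLeviGL F ![false, false, true]),
      ∫⁻ u : ↥(unipotentRadicalGL F ![false, false, true]),
          φ ((v : GL (Fin 3) F) * ((u : GL (Fin 3) F) * (γ : GL (Fin 3) F)) * (v : GL (Fin 3) F)⁻¹) ∂μU =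
        ∫⁻ u : ↥(unipotentRadicalGL F ![false, false, true]),
          φ ((u : GL (Fin 3) F) * ((v : GL (Fin 3) F) * (γ : GL (Fin 3) F) * (v : GL (Fin 3) F)⁻¹)) ∂μU := by
    intro v
    have h := lintegral_conj_eq_of_mem_unipotentRadicalGL (c := ![false, false, true])
      (c' := (id : Fin 3 → Fin 3)) monotone_id hmono rfl μU ⟨(v : GL (Fin 3) F), hNP v.2.1⟩ v.2.1
      (fun g => φ (g * ((v : GL (Fin 3) F) * (γ : GL (Fin 3) F) * (v : GL (Fin 3) F)⁻¹)))
    rw [← h]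
    refine lintegral_congr fun u => ?_
    congr 1
    group
  simp_rw [hD]
  -- (E) the substitution on `V ≅ F`: `v γ v⁻¹ = w(b x) γ` for `v = w x`
  have hwinv : ∀ x, (w (-x) : ↥(unipotentRadicalGL F (id : Fin 3 → Fin 3) ⊓
      standardLeviGL F ![false, false, true])) = (w x)⁻¹ := by
    intro x
    rw [eq_inv_iff_mul_eq_one, ← hwadd, neg_add_cancel]
    have := hwadd 0 0
    rw [add_zero] at this
    exact left_eq_mul.1 this |>.symm ▸ rfl
  have h01' : (0 : Fin 3) ≠ 1 := by decide
  have hDD : Matrix.diagonal (fun k => (((t k)⁻¹ : Fˣ) : F)) * Matrix.diagonal (fun k => (t k : F)) =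
      (1 : Matrix (Fin 3) (Fin 3) F) := by
    rw [Matrix.diagonal_mul_diagonal, ← Matrix.diagonal_one]
    congr 1; funext k; simp
  have hE0 : ∀ x : F,
      (w x).1 * (γ : GL (Fin 3) F) * ((w x).1)⁻¹ = (w (b * x)).1 * (γ : GL (Fin 3) F) := by
    intro x
    rw [← Subgroup.coe_inv, ← hwinv x]
    apply Units.ext
    rw [Units.val_mul, Units.val_mul, Units.val_mul, hw, hw, hw, hγ, coe_glDiagonal]
    have key := diagonal_mul_transvection_mul_diagonal_inv t h01' (-x)
    calc Matrix.transvection 0 1 x * Matrix.diagonal (fun k => (t k : F)) * Matrix.transvection 0 1 (-x)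
        = Matrix.transvection 0 1 x * (Matrix.diagonal (fun k => (t k : F)) *
            Matrix.transvection 0 1 (-x) * Matrix.diagonal (fun k => (((t k)⁻¹ : Fˣ) : F)) *
            Matrix.diagonal (fun k => (t k : F))) := by
          rw [Matrix.mul_assoc (Matrix.diagonal _ * Matrix.transvection 0 1 (-x)), hDD,
            Matrix.mul_one, Matrix.mul_assoc]
      _ = Matrix.transvection 0 1 (b * x) * Matrix.diagonal (fun k => (t k : F)) := by
          rw [key, ← Matrix.mul_assoc, Matrix.transvection_mul_transvection_same _ _ h01']
          congr 2
          rw [hb, Units.val_inv_eq_inv_val]; ring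
  have hmw : ∀ H : GL (Fin 3) F → ℝ≥0∞,
      ∫⁻ v, H (v : GL (Fin 3) F) ∂αV = ∫⁻ x, H (w x).1 ∂μF := by
    intro H
    rw [hαV, ← Homeomorph.toMeasurableEquiv_coe, lintegral_map_equiv]
  have hE : ∀ H : GL (Fin 3) F → ℝ≥0∞,
      ∫⁻ v, H ((v : GL (Fin 3) F) * (γ : GL (Fin 3) F) * (v : GL (Fin 3) F)⁻¹) ∂αV =
        ((normAbs F b⁻¹ : ℝ≥0) : ℝ≥0∞) * ∫⁻ v, H ((v : GL (Fin 3) F) * (γ : GL (Fin 3) F)) ∂αV := by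
    intro H
    rw [hmw (fun g => H (g * (γ : GL (Fin 3) F) * g⁻¹)), hmw (fun g => H (g * (γ : GL (Fin 3) F)))]
    simp only [hE0]
    have hsub := lintegral_map_equiv (fun y : F => H ((w y).1 * (γ : GL (Fin 3) F)))
      (MeasurableEquiv.mulLeft₀ b hb0) (μ := μF)
    rw [MeasurableEquiv.coe_mulLeft₀, map_mul_left_addHaar μF hb0, lintegral_smul_measure,
      smul_eq_mul] at hsub
    exact hsub.symm
  have hE' := hE (fun g => ∫⁻ u : ↥(unipotentRadicalGL F ![false, false, true]),
    φ ((u : GL (Fin 3) F) * g) ∂μU)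
  rw [hE']
  -- (F) for each `v`: `∫ φ(u (v γ)) du = ∫ φ(v u γ) du` (conjugation by `v⁻¹` preserves `μ_U`)
  have hF : ∀ v : ↥(unipotentRadicalGL F (id : Fin 3 → Fin 3) ⊓ standardLeviGL F ![false, false, true]),
      ∫⁻ u : ↥(unipotentRadicalGL F ![false, false, true]),
          φ ((u : GL (Fin 3) F) * ((v : GL (Fin 3) F) * (γ : GL (Fin 3) F))) ∂μU =
        ∫⁻ u : ↥(unipotentRadicalGL F ![false, false, true]),
          φ ((v : GL (Fin 3) F) * (u : GL (Fin 3) F) * (γ : GL (Fin 3) F)) ∂μU := by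
    intro v
    have hvinv : (((⟨(v : GL (Fin 3) F), hNP v.2.1⟩ : standardParabolicGL F ![false, false, true])⁻¹ :
        standardParabolicGL F ![false, false, true]) : GL (Fin 3) F) ∈
        unipotentRadicalGL F (id : Fin 3 → Fin 3) := by
      rw [Subgroup.coe_inv]; exact Subgroup.inv_mem _ v.2.1
    have h := lintegral_conj_eq_of_mem_unipotentRadicalGL (c := ![false, false, true])
      (c' := (id : Fin 3 → Fin 3)) monotone_id hmono rfl μU
      ((⟨(v : GL (Fin 3) F), hNP v.2.1⟩ : standardParabolicGL F ![false, false, true])⁻¹) hvinv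
      (fun g => φ ((v : GL (Fin 3) F) * g * (γ : GL (Fin 3) F)))
    rw [← h]
    refine lintegral_congr fun u => ?_
    congr 1
    simp only [Subgroup.coe_inv, inv_inv]
    group
  simp_rw [hF]
  rw [ENNReal.coe_mul]
  ring

end Assembly

end Literature.NumberTheory.Automorphic
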